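import Summits.CriticalPhenomena.PercolationContinuityZ3.Theses.PercBurnResprinkle
import Literature.Probability.Percolation.HalfSpace
import Literature.Probability.Percolation.FiniteClustersPercolation

/-!
# Sketch — crux-ideate for `VacantSetPercolates` (stmt-CriticalPhenomena-7205), ideator 3, round 1

First lemmas of the two idea cards `certified-slab-window-seal` (A) and `planar-trace-sharpness` (B),
stated over existing declarations. Nothing here is proved; everything must elaborate.
-/

namespace Summit.CriticalPhenomena.PercolationContinuityZ3.Cruxes.VacantSetPercolates.Sketch

open Literature.Probability.Percolation Literature.Probability.LatticeModels MeasureTheory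

/-- vertices of `ℤ³` -/
abbrev V3 : Type := Site 3

/-- The vacant set of a configuration: vertices whose open cluster is finite (GHK's `X`). -/
def vacantSet (ω : BondConfig V3) : Set V3 := {y | (openCluster ω y).Finite}

/-! ## Card A — certified slab window + sealed slab clusters -/

/-- The centred slab `{-m ≤ x₀ ≤ m}` (thickness `2m+1`, mid-plane `x₀ = 0` through the origin). -/
def cslabSet (m : ℕ) : Set V3 := {x | -(m : ℤ) ≤ x 0 ∧ x 0 ≤ (m : ℤ)}

/-- The configuration restricted to the slab: open edges with both endpoints in the slab. -/
def slabRestrict (m : ℕ) (ω : BondConfig V3) : BondConfig V3 :=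
  {e | e ∈ ω ∧ ∀ y ∈ e, y ∈ cslabSet m}

/-- `x` is `m`-SEALED in `ω`: it lies in the slab, its slab-cluster is finite, and no vertex of that
slab-cluster has an open edge of `ω` leaving the slab.  A local certificate of vacancy that does not
mention `p`, `p_c` or the infinite cluster. -/
def IsSealed (m : ℕ) (ω : BondConfig V3) (x : V3) : Prop :=
  x ∈ cslabSet m ∧ (openCluster (slabRestrict m ω) x).Finite ∧
    ∀ y ∈ openCluster (slabRestrict m ω) x, ∀ z : V3, s(y, z) ∈ ω → z ∈ cslabSet m

/-- FIRST LEMMA of card A (deterministic, provable now by induction on walks): a sealed vertex is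
vacant, for EVERY configuration (its `ω`-cluster equals its slab-cluster). -/
def SealedIsVacant : Prop :=
  ∀ (m : ℕ) (ω : BondConfig V3) (x : V3), IsSealed m ω x → x ∈ vacantSet ω

/-- The sealed configuration: lattice edges of `ℤ³` both of whose endpoints are `m`-sealed (the
induced subgraph of `ℤ³` on the sealed set `Σ_m(ω)`; its clusters are subsets of vacant components). -/
def sealedConfig (m : ℕ) (ω : BondConfig V3) : BondConfig V3 :=
  {e | e ∈ (zdGraph 3).edgeSet ∧ ∀ y ∈ e, IsSealed m ω y}

/-- Reduction of card A (provable now from `SealedIsVacant` + monotonicity of clusters in the edge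
set): if for some `m` and some `p > p_c(ℤ³)` the origin lies with positive probability in an infinite
component of the sealed set, then `VacantSetPercolates`. -/
def SlabWindowReduction : Prop :=
  (∃ m : ℕ, ∃ p : unitInterval, criticalProb (zdGraph 3) (0 : V3) < (p : ℝ) ∧
      0 < (bondPercolation (zdGraph 3) p).real {ω | (openCluster (sealedConfig m ω) (0 : V3)).Infinite})
    → Summit.CriticalPhenomena.PercolationContinuityZ3.Theses.PercBurnResprinkle.VacantSetPercolates

/-- The certified window (Aizenman–Grimmett strictness for slabs / Grimmett–Marstrand): every slab
threshold lies strictly above `p_c(ℤ³)`, so any `p ∈ [p_c(S_{4m}), p_c(S_{2m}))` is certified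
supercritical for `ℤ³` and subcritical for the slab of thickness `2m` — without knowing `p_c(ℤ³)`. -/
def SlabStrict : Prop :=
  ∀ k : ℕ, criticalProb (zdGraph 3) (0 : V3) < criticalProb (slabGraph 3 k) (slabOrigin 3 k)

/-- The crux of line A ("sealed sets percolate somewhere in a certified window"): for some `m` the
sealed set percolates at some parameter at least `p_c(S_{4m})` (hence, by `SlabStrict`, above
`p_c(ℤ³)`).  Blocking it requires a face-to-face CURTAIN of face-hung finite subcritical blobs. -/
def SealedPercolatesInWindow : Prop :=
  ∃ m : ℕ, ∃ p : unitInterval,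
    criticalProb (slabGraph 3 (4 * m)) (slabOrigin 3 (4 * m)) ≤ (p : ℝ) ∧
      0 < (bondPercolation (zdGraph 3) p).real {ω | (openCluster (sealedConfig m ω) (0 : V3)).Infinite}

/-! ## Card B — planar trace: independence-free RSW + sharp threshold -/

/-- The coordinate plane `x₀ = 0`. -/
def plane0 : Set V3 := {x | x 0 = 0}

/-- Planar vacant configuration: lattice edges inside the plane `x₀ = 0` with both endpoints vacant
(nearest-neighbour site percolation of `Y_p = V_p ∩ plane` in `ℤ²`). -/
def planarVacantConfig (ω : BondConfig V3) : BondConfig V3 :=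
  {e | e ∈ (zdGraph 3).edgeSet ∧ ∀ y ∈ e, y ∈ plane0 ∧ y ∈ vacantSet ω}

/-- FIRST LEMMA of card B (provable now: a planar vacant path is a vacant path): a planar witness gives
`VacantSetPercolates`. -/
def PlanarWitnessReduction : Prop :=
  (∃ p : unitInterval, criticalProb (zdGraph 3) (0 : V3) < (p : ℝ) ∧
      0 < (bondPercolation (zdGraph 3) p).real {ω | (openCluster (planarVacantConfig ω) (0 : V3)).Infinite})
    → Summit.CriticalPhenomena.PercolationContinuityZ3.Theses.PercBurnResprinkle.VacantSetPercolates

/-- Planar `*`-adjacency (sup-norm one) inside the plane `x₀ = 0`. -/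
def starAdj (x y : V3) : Prop := x ≠ y ∧ x ∈ plane0 ∧ y ∈ plane0 ∧ ∀ i, |x i - y i| ≤ 1

/-- The TRACE `Z_p = I_p ∩ plane` `*`-crosses the annulus `[-3n,3n]² ∖ (-n,n)²` of the plane: a `*`-chain
of NON-vacant plane sites from the inner square to the outer boundary.  An INCREASING event of the
i.i.d. edge field (sites join the infinite cluster as edges open) — hence OSSS/sharp-threshold
technology applies to `p ↦ P_p(TraceAnnulusCrossing n)`. -/
def TraceAnnulusCrossing (n : ℕ) : Set (BondConfig V3) :=
  {ω | ∃ (l : ℕ) (γ : Fin (l + 1) → V3),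
      (∀ i, γ i ∈ plane0 ∧ γ i ∉ vacantSet ω ∧ |γ i 1| ≤ 3 * n ∧ |γ i 2| ≤ 3 * n) ∧
      (|γ 0 1| ≤ n ∧ |γ 0 2| ≤ n) ∧ (|γ (Fin.last l) 1| = 3 * n ∨ |γ (Fin.last l) 2| = 3 * n) ∧
      ∀ i : Fin l, starAdj (γ i.castSucc) (γ i.succ)}

/-- Right-continuity at `p_c` of the trace-crossing probabilities (provable now: as `p ↓ p_c` the
events decrease to the event at `p_c`, up to a null set, in the monotone coupling; continuity of
measure from above).  In a continuity world the limit is `0` for every `n`. -/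
def TraceCrossingRightContinuous : Prop :=
  ∀ n : ℕ, Filter.Tendsto (fun p : unitInterval => (bondPercolation (zdGraph 3) p).real (TraceAnnulusCrossing n))
    (nhdsWithin (criticalProbI 3) (Set.Ioi (criticalProbI 3)))
    (nhds ((bondPercolation (zdGraph 3) (criticalProbI 3)).real (TraceAnnulusCrossing n)))

/-- The crux of line B, "the trace is not planar-supercritical at one certified-supercritical
parameter and one scale beyond its correlation length": `κ_trace < ε`.  (The scale condition
`n ≥ C ξ(p) log n`, needed for the quasi-locality of the trace, is carried informally on the card; here
only the shape.)  With independence-free RSW + `nn/*` duality this gives planar percolation of `Y_p`. -/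
def TraceNotSupercritical (ε : ℝ) : Prop :=
  ∃ p : unitInterval, criticalProb (zdGraph 3) (0 : V3) < (p : ℝ) ∧
    ∃ n : ℕ, 1 ≤ n ∧ (bondPercolation (zdGraph 3) p).real (TraceAnnulusCrossing n) < ε

/-- Sanity: membership in the vacant set is the negated `Infinite` used inline by the crux and by
the vendored `finiteClustersConfig` (`p_fin` vocabulary), so both reductions can equally be phrased
via `pFin 3`. -/
theorem mem_vacantSet_iff (ω : BondConfig V3) (y : V3) :
    y ∈ vacantSet ω ↔ ¬ (openCluster ω y).Infinite :=
  Set.not_infinite.symm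

end Summit.CriticalPhenomena.PercolationContinuityZ3.Cruxes.VacantSetPercolates.Sketch
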